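import Literature.Computability.AlgebraicComplexity.LMR13ImmanantHessianForm
import HarnessLib

/-!
# Immanants at the sparse corank-one point of the four-term relations (LMR 2013 §3.4, support)

Cell `val-lit`, row `LMR13-A` (val-lit-p8 g3; the `IM_λ`-side evaluations for val-lit-p7's
sparse-point route to LMR Lemma 3.4.1, lead-lmr 17:39Z). Honest framing: two evaluation lemmas
inside the typed literature of LMR 2013; VP ≠ VNP is NOT proved and nothing here is progress on it.

Landsberg–Manivel–Ressayre 2013 prove Lemma 3.4.1 (journal p. 479: "for any permutation `σ`, and
any triple of distinct integers `i, p, q` smaller than `n`, `Σ_{τ ∈ ⟨(ip),(qn)⟩} χ_λ(στ) = 0`"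
whenever `IM_λ ∈ T̂_{[det_n]}𝒟ual_{2n−2,n,n²}`) by a coefficient extraction in the parametrisation of
§3.4 (arXiv `p0007–p0008`). The tree's route (val-lit-p7, (Zarb) + Lemma 3.3.2,
`LMR13TangentAtDet.lean`) evaluates instead at ONE sparse point per relation: for `σ ∈ 𝔖_n` and
pairwise distinct `a, c, k, m`,
`w = P_σ + E_{k,σ(m)} + E_{m,σ(k)}` (the permutation matrix of `σ` with the `2 × 2` block of rows
`k, m` and columns `σ(k), σ(m)` filled with ones; rank `n − 1`) and `X = E_{a,σ(c)} + E_{c,σ(a)}`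
(in the radical of the Hessian form of `det_n` at `w`). This file supplies the `IM_λ` side:

* `prod_sparsePoint_eq_ite` — along a permutation `ρ`, `∏_r w_{r,ρ(r)}` is `1` iff
  `ρ ∈ {σ, σ·(km)}` and `0` otherwise (the `0/1` pattern of `w`);
* **`eval_immanant_sparsePoint`** — `IM_λ(w) = χ_λ(σ) + χ_λ(σ·(km))`;
* **`dotProduct_hessianMatrix_immanant_sparsePoint`** —
  `Xᵀ · Hess(IM_λ)(w) · X = 2·(χ_λ(σ·(ac)) + χ_λ(σ·(ac)·(km)))` (from val-lit-t10's
  `dotProduct_hessianMatrix_immanant_mulVec`: only `ρ ∈ σ·(ac)·{1, (km)}` survive).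

With `c = −2` in Lemma 3.3.2 these two values give exactly the printed four-term relation
`χ(σ) + χ(σ(ac)) + χ(σ(km)) + χ(σ(ac)(km)) = 0` (val-lit-p7's assembly). The point `w` and the
vector `X` enter only through the hypotheses `hw`, `hX` spelling out their entries, so that any
definition of them can be plugged in.

## References
* [LandsbergManivelRessayre2013] J. M. Landsberg, L. Manivel, N. Ressayre, *Hypersurfaces with
  degenerate duals and the Geometric Complexity Theory Program*, Comment. Math. Helv. 88 (2013)
  469–484, §3.4, Lemma 3.4.1 (p. 479).
-/

noncomputable section

open MvPolynomial Equiv Matrix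

namespace Literature.Computability.AlgebraicComplexity

open _root_.Literature.NumberTheory.DiophantineGeometry (spechtCharacter)

variable {n : ℕ}

section SparsePoint

variable {σ : Equiv.Perm (Fin n)} {k m : Fin n} {w : Fin n × Fin n → ℂ}

/-- The admissible positions of the sparse point: `w_{r,col} = 1` iff `col = σ(r)`, or `r = k` and
`col = σ(m)`, or `r = m` and `col = σ(k)`; these three cases are mutually exclusive.
[cite: LandsbergManivelRessayre2013, Lemma 3.4.1 (p. 479)] -/
theorem sparsePoint_apply_eq_ite (hkm : k ≠ m)
    (hw : ∀ p : Fin n × Fin n, w p = (if p.2 = σ p.1 then 1 else 0) +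
      (if p.1 = k ∧ p.2 = σ m then 1 else 0) + (if p.1 = m ∧ p.2 = σ k then 1 else 0))
    (p : Fin n × Fin n) :
    w p = if p.2 = σ p.1 ∨ (p.1 = k ∧ p.2 = σ m) ∨ (p.1 = m ∧ p.2 = σ k) then 1 else 0 := by
  rw [hw p]
  by_cases hA : p.2 = σ p.1
  · have hB : ¬ (p.1 = k ∧ p.2 = σ m) := fun h => hkm (σ.injective (by rw [← h.2, hA, h.1]))
    have hC : ¬ (p.1 = m ∧ p.2 = σ k) := fun h => hkm (σ.injective (by rw [← h.2, hA, h.1]))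
    rw [if_pos hA, if_neg hB, if_neg hC, if_pos (Or.inl hA)]
    norm_num
  · by_cases hB : p.1 = k ∧ p.2 = σ m
    · have hC : ¬ (p.1 = m ∧ p.2 = σ k) := fun h => hkm (hB.1.symm.trans h.1)
      rw [if_neg hA, if_pos hB, if_neg hC, if_pos (Or.inr (Or.inl hB))]
      norm_num
    · by_cases hC : p.1 = m ∧ p.2 = σ k
      · rw [if_neg hA, if_neg hB, if_pos hC, if_pos (Or.inr (Or.inr hC))]
        norm_num
      · rw [if_neg hA, if_neg hB, if_neg hC, if_neg (not_or.2 ⟨hA, not_or.2 ⟨hB, hC⟩⟩)]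
        norm_num

/-- A permutation `ρ` runs inside the support of the sparse point iff `ρ = σ` or `ρ = σ·(km)`.
[cite: LandsbergManivelRessayre2013, Lemma 3.4.1 (p. 479)] -/
theorem forall_sparse_iff (hkm : k ≠ m) (ρ : Equiv.Perm (Fin n)) :
    (∀ r : Fin n, ρ r = σ r ∨ (r = k ∧ ρ r = σ m) ∨ (r = m ∧ ρ r = σ k)) ↔
      ρ = σ ∨ ρ = σ * swap k m := by
  constructor
  · intro h
    by_cases hk : ρ k = σ k
    · left
      refine Equiv.ext fun r => ?_
      rcases h r with hr | ⟨rfl, hr⟩ | ⟨rfl, hr⟩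
      · exact hr
      · exact absurd (σ.injective (hk.symm.trans hr)) hkm
      · exact absurd (ρ.injective (hr.trans hk.symm)) hkm.symm
    · right
      have hk' : ρ k = σ m := by
        rcases h k with hr | ⟨-, hr⟩ | ⟨hr, -⟩
        · exact absurd hr hk
        · exact hr
        · exact absurd hr hkm
      have hm' : ρ m = σ k := by
        rcases h m with hr | ⟨hr, -⟩ | ⟨-, hr⟩
        · exact absurd (ρ.injective (hk'.trans hr.symm)) hkm
        · exact absurd hr hkm.symm
        · exact hr
      refine Equiv.ext fun r => ?_
      rw [Perm.mul_apply]
      by_cases hrk : r = k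
      · rw [hrk, swap_apply_left, hk']
      · by_cases hrm : r = m
        · rw [hrm, swap_apply_right, hm']
        · rw [swap_apply_of_ne_of_ne hrk hrm]
          rcases h r with hr | ⟨hr, -⟩ | ⟨hr, -⟩
          · exact hr
          · exact absurd hr hrk
          · exact absurd hr hrm
  · rintro (rfl | rfl) r
    · exact Or.inl rfl
    · rw [Perm.mul_apply]
      by_cases hrk : r = k
      · exact Or.inr (Or.inl ⟨hrk, by rw [hrk, swap_apply_left]⟩)
      · by_cases hrm : r = m
        · exact Or.inr (Or.inr ⟨hrm, by rw [hrm, swap_apply_right]⟩)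
        · exact Or.inl (by rw [swap_apply_of_ne_of_ne hrk hrm])

/-- **The `0/1` pattern of the sparse point along a permutation**: `∏_r w_{r,ρ(r)} = 1` if
`ρ ∈ {σ, σ·(km)}` and `0` otherwise. [cite: LandsbergManivelRessayre2013, Lemma 3.4.1 (p. 479)] -/
theorem prod_sparsePoint_eq_ite (hkm : k ≠ m)
    (hw : ∀ p : Fin n × Fin n, w p = (if p.2 = σ p.1 then 1 else 0) +
      (if p.1 = k ∧ p.2 = σ m then 1 else 0) + (if p.1 = m ∧ p.2 = σ k then 1 else 0))
    (ρ : Equiv.Perm (Fin n)) :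
    ∏ r : Fin n, w (r, ρ r) = if ρ = σ ∨ ρ = σ * swap k m then 1 else 0 := by
  simp only [sparsePoint_apply_eq_ite hkm hw, Fintype.prod_boole, forall_sparse_iff hkm ρ]

/-- **`IM_λ(w) = χ_λ(σ) + χ_λ(σ·(km))`** at the sparse point.
[cite: LandsbergManivelRessayre2013, Lemma 3.4.1 (p. 479)] -/
theorem eval_immanant_sparsePoint (lam : Nat.Partition n) (hkm : k ≠ m)
    (hw : ∀ p : Fin n × Fin n, w p = (if p.2 = σ p.1 then 1 else 0) +
      (if p.1 = k ∧ p.2 = σ m then 1 else 0) + (if p.1 = m ∧ p.2 = σ k then 1 else 0)) :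
    eval w (immanant lam) = spechtCharacter ℂ lam σ + spechtCharacter ℂ lam (σ * swap k m) := by
  classical
  have hne : σ ≠ σ * swap k m := by
    intro h
    have := congrArg (fun τ : Equiv.Perm (Fin n) => τ k) h
    simp only [Perm.mul_apply, swap_apply_left] at this
    exact hkm (σ.injective this)
  rw [immanant, map_sum]
  simp only [smul_eval, map_prod, eval_X, prod_sparsePoint_eq_ite hkm hw, mul_ite, mul_one, mul_zero]
  rw [Finset.sum_ite, Finset.sum_const_zero, add_zero]
  have hfilter : (Finset.univ.filter fun ρ : Equiv.Perm (Fin n) => ρ = σ ∨ ρ = σ * swap k m) =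
      {σ, σ * swap k m} := by
    ext ρ
    simp
  rw [hfilter, Finset.sum_pair hne]

end SparsePoint

section HessianForm

variable {σ : Equiv.Perm (Fin n)} {a c k m : Fin n} {w X : Fin n × Fin n → ℂ}

/-- The double sum of the immanant Hessian form at the sparse vector `X = E_{a,σ(c)} + E_{c,σ(a)}`
collapses to the two ordered pairs `(a,c)`, `(c,a)`. [cite: LandsbergManivelRessayre2013, Lemma 3.4.1 (p. 479)] -/
theorem sum_sum_sparseVec (hac : a ≠ c)
    (hX : ∀ p : Fin n × Fin n, X p = (if p.1 = a ∧ p.2 = σ c then 1 else 0) +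
      (if p.1 = c ∧ p.2 = σ a then 1 else 0))
    (ρ : Equiv.Perm (Fin n)) (P : Fin n → Fin n → ℂ) (hP : P c a = P a c) :
    ∑ a', ∑ c' ∈ Finset.univ.erase a', X (a', ρ a') * X (c', ρ c') * P a' c' =
      if ρ a = σ c ∧ ρ c = σ a then 2 * P a c else 0 := by
  classical
  -- the entries of `X` along `ρ`
  have hXa' : ∀ a', X (a', ρ a') =
      (if a' = a ∧ ρ a = σ c then 1 else 0) + (if a' = c ∧ ρ c = σ a then 1 else 0) := by
    intro a'
    rw [hX]
    by_cases h1 : a' = a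
    · rw [h1]; simp [hac]
    · by_cases h2 : a' = c
      · rw [h2]; simp [Ne.symm hac]
      · simp [h1, h2]
  have hzero : ∀ a', a' ≠ a → a' ≠ c → X (a', ρ a') = 0 := by
    intro a' h1 h2
    rw [hXa']; simp [h1, h2]
  have hXa : X (a, ρ a) = if ρ a = σ c then 1 else 0 := by rw [hXa']; simp [hac]
  have hXc : X (c, ρ c) = if ρ c = σ a then 1 else 0 := by rw [hXa']; simp [Ne.symm hac]
  -- outer sum: only `a' ∈ {a, c}`
  rw [Finset.sum_eq_add a c hac (fun a' _ h => by
      refine Finset.sum_eq_zero fun c' _ => ?_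
      rw [hzero a' h.1 h.2, zero_mul, zero_mul])
    (fun h => absurd (Finset.mem_univ _) h) (fun h => absurd (Finset.mem_univ _) h)]
  -- inner sums: only `c' = c`, resp. `c' = a`
  rw [Finset.sum_eq_single_of_mem c (Finset.mem_erase.2 ⟨Ne.symm hac, Finset.mem_univ _⟩)
      (fun c' hc' hne => by
        rw [hzero c' (Finset.mem_erase.1 hc').1 hne, mul_zero, zero_mul]),
    Finset.sum_eq_single_of_mem a (Finset.mem_erase.2 ⟨hac, Finset.mem_univ _⟩)
      (fun c' hc' hne => by
        rw [hzero c' hne (Finset.mem_erase.1 hc').1, mul_zero, zero_mul]),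
    hXa, hXc, hP]
  by_cases h1 : ρ a = σ c
  · by_cases h2 : ρ c = σ a
    · simp only [h1, h2, and_self, if_true]
      ring
    · simp [h1, h2]
  · simp [h1]

/-- Along `ρ` with `ρ(a) = σ(c)`, `ρ(c) = σ(a)`, the sparse point `w` (whose special rows `k, m`
avoid `a, c`) supports the remaining product iff `ρ·(ac) ∈ {σ, σ·(km)}`.
[cite: LandsbergManivelRessayre2013, Lemma 3.4.1 (p. 479)] -/
theorem prod_erase_erase_sparsePoint_eq_ite (hkm : k ≠ m)
    (hw : ∀ p : Fin n × Fin n, w p = (if p.2 = σ p.1 then 1 else 0) +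
      (if p.1 = k ∧ p.2 = σ m then 1 else 0) + (if p.1 = m ∧ p.2 = σ k then 1 else 0))
    {ρ : Equiv.Perm (Fin n)} (hρa : ρ a = σ c) (hρc : ρ c = σ a) :
    ∏ i ∈ (Finset.univ.erase a).erase c, w (i, ρ i) =
      if ρ * swap a c = σ ∨ ρ * swap a c = σ * swap k m then 1 else 0 := by
  classical
  have hiff : (∀ r ∈ (Finset.univ.erase a).erase c,
      ρ r = σ r ∨ (r = k ∧ ρ r = σ m) ∨ (r = m ∧ ρ r = σ k)) ↔
        ρ * swap a c = σ ∨ ρ * swap a c = σ * swap k m := by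
    rw [← forall_sparse_iff hkm (ρ * swap a c)]
    refine ⟨fun h r => ?_, fun h r hr => ?_⟩
    · rw [Perm.mul_apply]
      by_cases hra : r = a
      · rw [hra, swap_apply_left, hρc]; exact Or.inl rfl
      · by_cases hrc : r = c
        · rw [hrc, swap_apply_right, hρa]; exact Or.inl rfl
        · rw [swap_apply_of_ne_of_ne hra hrc]
          exact h r (Finset.mem_erase.2 ⟨hrc, Finset.mem_erase.2 ⟨hra, Finset.mem_univ r⟩⟩)
    · have hrc : r ≠ c := (Finset.mem_erase.1 hr).1
      have hra : r ≠ a := (Finset.mem_erase.1 (Finset.mem_erase.1 hr).2).1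
      have := h r
      rwa [Perm.mul_apply, swap_apply_of_ne_of_ne hra hrc] at this
  simp only [sparsePoint_apply_eq_ite hkm hw, Finset.prod_boole, hiff]

/-- **`Xᵀ · Hess(IM_λ)(w) · X = 2 (χ_λ(σ·(ac)) + χ_λ(σ·(ac)·(km)))`** at the sparse point `w` and the
sparse vector `X`, for `a, c, k, m` pairwise distinct: in val-lit-t10's expansion
`Xᵀ Hess IM_λ(w) X = Σ_ρ χ_λ(ρ) Σ_{a'≠c'} X_{a'ρ(a')} X_{c'ρ(c')} ∏_{i≠a',c'} w_{iρ(i)}` only the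
ordered pairs `(a',c') ∈ {(a,c),(c,a)}` and the permutations `ρ ∈ {σ(ac), σ(ac)(km)}` survive.
[cite: LandsbergManivelRessayre2013, Lemma 3.4.1 (p. 479)] -/
theorem dotProduct_hessianMatrix_immanant_sparsePoint (lam : Nat.Partition n) (hkm : k ≠ m)
    (hac : a ≠ c) (hak : a ≠ k) (ham : a ≠ m) (hck : c ≠ k) (hcm : c ≠ m)
    (hw : ∀ p : Fin n × Fin n, w p = (if p.2 = σ p.1 then 1 else 0) +
      (if p.1 = k ∧ p.2 = σ m then 1 else 0) + (if p.1 = m ∧ p.2 = σ k then 1 else 0))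
    (hX : ∀ p : Fin n × Fin n, X p = (if p.1 = a ∧ p.2 = σ c then 1 else 0) +
      (if p.1 = c ∧ p.2 = σ a then 1 else 0)) :
    X ⬝ᵥ (hessianMatrix (immanant lam) w *ᵥ X) =
      2 * (spechtCharacter ℂ lam (σ * swap a c) + spechtCharacter ℂ lam (σ * swap a c * swap k m)) := by
  classical
  rw [dotProduct_hessianMatrix_immanant_mulVec]
  -- the inner double sum for each `ρ`
  have hinner : ∀ ρ : Equiv.Perm (Fin n),
      (∑ a', ∑ c' ∈ Finset.univ.erase a',
        X (a', ρ a') * X (c', ρ c') * ∏ i ∈ (Finset.univ.erase a').erase c', w (i, ρ i)) =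
        if ρ = σ * swap a c ∨ ρ = σ * swap a c * swap k m then 2 else 0 := by
    intro ρ
    rw [sum_sum_sparseVec hac hX ρ (fun a' c' => ∏ i ∈ (Finset.univ.erase a').erase c', w (i, ρ i))
      (by rw [Finset.erase_right_comm])]
    by_cases hρ : ρ a = σ c ∧ ρ c = σ a
    · rw [if_pos hρ, prod_erase_erase_sparsePoint_eq_ite hkm hw hρ.1 hρ.2]
      have hswap : ∀ τ : Equiv.Perm (Fin n), ρ * swap a c = τ ↔ ρ = τ * swap a c := fun τ => by
        rw [← eq_mul_inv_iff_mul_eq, swap_inv]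
      have hcomm : σ * swap k m * swap a c = σ * swap a c * swap k m := by
        have hd : Perm.Disjoint (swap k m) (swap a c) :=
          Perm.disjoint_swap_swap (by simp [hkm, hak.symm, ham.symm, hck.symm, hcm.symm, hac])
        rw [mul_assoc, mul_assoc, hd.commute.eq]
      simp only [hswap, hcomm]
      split_ifs <;> ring
    · rw [if_neg hρ, if_neg]
      rintro (rfl | rfl)
      · exact hρ ⟨by simp [Perm.mul_apply], by simp [Perm.mul_apply]⟩
      · refine hρ ⟨?_, ?_⟩
        · rw [Perm.mul_apply, Perm.mul_apply, swap_apply_of_ne_of_ne hak ham, swap_apply_left]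
        · rw [Perm.mul_apply, Perm.mul_apply, swap_apply_of_ne_of_ne hck hcm, swap_apply_right]
  simp only [hinner, mul_ite, mul_zero]
  rw [Finset.sum_ite, Finset.sum_const_zero, add_zero]
  have hne : σ * swap a c ≠ σ * swap a c * swap k m := by
    intro h
    rw [left_eq_mul, swap_eq_one_iff] at h
    exact hkm h
  have hfilter : (Finset.univ.filter fun ρ : Equiv.Perm (Fin n) =>
      ρ = σ * swap a c ∨ ρ = σ * swap a c * swap k m) = {σ * swap a c, σ * swap a c * swap k m} := by
    ext ρ
    simp
  rw [hfilter, Finset.sum_pair hne]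
  ring

end HessianForm

end Literature.Computability.AlgebraicComplexity

end
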